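import Summits.Ventures.PercRepro.C026InteriorFlip

/-!
# The double flip sends every Bad source to a Good one (mine-3 §41 (d); p6, gen 18)

For a `(D,A)` configuration `T` with marks `a, b, c` let `D_a = cluster Tᶜ a`, `D_b = cluster Tᶜ b`
be the blue clusters of the two terminals and `τ(T) := σ_a(σ_b(T))` the **double flip** (flip every
edge inside `D_b`, then every edge inside `D_a`; the two clusters are disjoint and each flip leaves
the other cluster unchanged).  mine-3's LEMMA §41 (d), in the tree's vocabulary:

* `doubleFlip_conn`, `doubleFlip_A`: `τ(T)` is again `(D,A)`;
* `good_doubleFlip`: `c` reaches `b` in `T` avoiding `D_a`, or `c` reaches `a` in `T` avoiding `D_b`,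
  or `c` reaches `a` in `τ(T)` avoiding the blue cluster of `b` in `τ(T)`, or `c` reaches `b` in
  `τ(T)` avoiding the blue cluster of `a` in `τ(T)` — «`T ∈ Good₁ ∪ Good₂` or `τ(T) ∈ Good₁ ∪ Good₂`»,
  so the double flip maps every Bad source to a Good one.  The proof is the two-cluster theorem
  (`two_cluster`) with `ω = T`, `τ = τ(T)`: a `T`-red path from `c` to a terminal, cut at its first
  vertex in `D_a ∪ D_b` (`exists_first_mem_of_reflTransGen`), is red in both configurations (its edges
  have an endpoint outside both clusters), the old blue spanning structure of the cluster it enters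
  is red in `τ(T)`, and the blue cluster of the other terminal in `τ(T)` is red-connected in `T`.
-/

namespace PercRepro

namespace MultiGraph

open Finset

variable {V E : Type*} (G : MultiGraph V E)

/-- The double flip `τ(T) = σ_a(σ_b(T))`: flip every edge inside the blue cluster of `b`, then every
edge inside the blue cluster of `a` (which the first flip leaves unchanged when `a ∉ D_b`). -/
noncomputable def doubleFlip (T : Config E) (a b : V) : Config E :=
  G.interiorFlip (G.interiorFlip T (G.cluster Tᶜ b))
    (G.cluster (G.interiorFlip T (G.cluster Tᶜ b))ᶜ a)

variable {G}

omit G in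
/-- Along a walk whose steps end in `Y`, starting in `Y`, every vertex is in `Y`. -/
theorem mem_of_reflTransGen_inside {α : Type*} {r : α → α → Prop} {Y : Set α} {x p : α}
    (hx : x ∈ Y) (h : Relation.ReflTransGen (fun u v => r u v ∧ v ∈ Y) x p) : p ∈ Y := by
  induction h with
  | refl => exact hx
  | tail _ hpq _ => exact hpq.2

/-- A walk inside `Y` transfers to any configuration in which the open edges inside `Y` stay open. -/
theorem WalkInside.map {ω ω' : Config E} {Y : Set V}
    (hstep : ∀ p q, p ∈ Y → q ∈ Y → G.OpenAdj ω p q → G.OpenAdj ω' p q) {x y : V}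
    (h : G.WalkInside ω Y x y) : G.WalkInside ω' Y x y := by
  obtain ⟨hx, hwalk⟩ := h
  refine ⟨hx, ?_⟩
  induction hwalk with
  | refl => exact Relation.ReflTransGen.refl
  | @tail p q hxp hpq ih =>
    exact ih.tail ⟨hstep p q (mem_of_reflTransGen_inside hx hxp) hpq.2 hpq.1, hpq.2⟩

/-- A walk inside `Y` is untouched by a flip inside a set disjoint from `Y`. -/
theorem WalkInside.interiorFlip_of_disjoint {ω : Config E} {Y Z : Set V} (hYZ : Disjoint Y Z)
    {x y : V} (h : G.WalkInside ω Y x y) : G.WalkInside (G.interiorFlip ω Z) Y x y :=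
  h.map fun _ _ hp _ hpq => openAdj_interiorFlip_of_not_mem (Set.disjoint_left.1 hYZ hp) hpq

/-- When `a` is not blue-joined to `b`, the second flip is inside the original blue cluster of `a`. -/
theorem doubleFlip_eq {T : Config E} {a b : V} (hab : ¬ G.Conn Tᶜ b a) :
    G.doubleFlip T a b = G.interiorFlip (G.interiorFlip T (G.cluster Tᶜ b)) (G.cluster Tᶜ a) := by
  unfold doubleFlip
  rw [cluster_compl_interiorFlip_of_not_mem (fun h => hab ((G.mem_cluster).1 h))]

/-- Red connectivity survives the double flip. -/
theorem doubleFlip_conn {T : Config E} {a b u v : V} (h : G.Conn T u v) :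
    G.Conn (G.doubleFlip T a b) u v :=
  conn_interiorFlip (conn_interiorFlip h)

/-- The double flip keeps blue type `A`: the three marks stay pairwise blue-separate. -/
theorem doubleFlip_A {T : Config E} {a b c : V} (hab : ¬ G.Conn Tᶜ a b) (hac : ¬ G.Conn Tᶜ a c)
    (hbc : ¬ G.Conn Tᶜ b c) :
    ¬ G.Conn (G.doubleFlip T a b)ᶜ a b ∧ ¬ G.Conn (G.doubleFlip T a b)ᶜ a c ∧
      ¬ G.Conn (G.doubleFlip T a b)ᶜ b c := by
  have hba : ¬ G.Conn Tᶜ b a := fun h => hab h.symm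
  rw [doubleFlip_eq hba]
  -- after the first flip (inside `D_b`) the marks are still pairwise separate
  obtain ⟨h1, h2, h3⟩ := interiorFlip_A (S := T) (j := b) (x := a) (y := c) hba hbc hac
  -- the second flip is inside `D_a`, which the first flip left unchanged
  have hA : G.cluster Tᶜ a = G.cluster (G.interiorFlip T (G.cluster Tᶜ b))ᶜ a :=
    (cluster_compl_interiorFlip_of_not_mem (fun h => hba ((G.mem_cluster).1 h))).symm
  rw [hA]
  obtain ⟨k1, k2, k3⟩ := interiorFlip_A (S := G.interiorFlip T (G.cluster Tᶜ b)) (j := a) (x := b)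
    (y := c) (fun h => h1 h.symm) h3 h2
  exact ⟨k1, k2, k3⟩

/-- An edge with an endpoint outside `D_a ∪ D_b` is untouched by the double flip. -/
theorem doubleFlip_apply_of_not_mem {T : Config E} {a b p : V} {e : E} (hab : ¬ G.Conn Tᶜ b a)
    (hpa : p ∉ G.cluster Tᶜ a) (hpb : p ∉ G.cluster Tᶜ b) (hend : G.fst e = p ∨ G.snd e = p) :
    G.doubleFlip T a b e = T e := by
  rw [doubleFlip_eq hab, interiorFlip_apply_of_not_both, interiorFlip_apply_of_not_both]
  · rcases hend with h | h
    · exact fun hh => hpb (h ▸ hh.1)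
    · exact fun hh => hpb (h ▸ hh.2)
  · rcases hend with h | h
    · exact fun hh => hpa (h ▸ hh.1)
    · exact fun hh => hpa (h ▸ hh.2)

/-- A `T`-open edge with an endpoint outside `D_a ∪ D_b` is open in `T ⊓ τ(T)`. -/
theorem openAdj_inf_doubleFlip_of_not_mem {T : Config E} {a b p q : V} (hab : ¬ G.Conn Tᶜ b a)
    (hpa : p ∉ G.cluster Tᶜ a) (hpb : p ∉ G.cluster Tᶜ b) (h : G.OpenAdj T p q) :
    G.OpenAdj (T ⊓ G.doubleFlip T a b) p q := by
  obtain ⟨e, he, hend⟩ := h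
  refine ⟨e, ?_, hend⟩
  have hend' : G.fst e = p ∨ G.snd e = p := by
    rcases hend with ⟨h1, _⟩ | ⟨_, h2⟩
    · exact Or.inl h1
    · exact Or.inr h2
  rw [Pi.inf_apply, doubleFlip_apply_of_not_mem hab hpa hpb hend', inf_idem]
  exact he

/-- Inside `D_a`, the old blue spanning structure is red after the double flip. -/
theorem walkInside_doubleFlip_of_mem_a {T : Config E} {a b x y : V} (hab : ¬ G.Conn Tᶜ b a)
    (hx : x ∈ G.cluster Tᶜ a) (hy : y ∈ G.cluster Tᶜ a) :
    G.WalkInside (G.doubleFlip T a b) (G.cluster Tᶜ a) x y := by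
  rw [doubleFlip_eq hab]
  have hA : G.cluster Tᶜ a = G.cluster (G.interiorFlip T (G.cluster Tᶜ b))ᶜ a :=
    (cluster_compl_interiorFlip_of_not_mem (fun h => hab ((G.mem_cluster).1 h))).symm
  rw [hA] at hx hy ⊢
  exact walkInside_interiorFlip_of_mem hx hy

/-- The blue cluster of `b` after the double flip lies inside `D_b`. -/
theorem cluster_doubleFlip_b_subset {T : Config E} {a b : V} (hab : ¬ G.Conn Tᶜ b a) :
    G.cluster (G.doubleFlip T a b)ᶜ b ⊆ G.cluster Tᶜ b := by
  have hba : ¬ G.Conn Tᶜ a b := fun h => hab h.symm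
  have hA : G.cluster Tᶜ a = G.cluster (G.interiorFlip T (G.cluster Tᶜ b))ᶜ a :=
    (cluster_compl_interiorFlip_of_not_mem (fun h => hab ((G.mem_cluster).1 h))).symm
  have hB : G.cluster (G.doubleFlip T a b)ᶜ b =
      G.cluster (G.interiorFlip T (G.cluster Tᶜ b))ᶜ b := by
    rw [doubleFlip_eq hab, hA]
    exact cluster_compl_interiorFlip_of_not_mem (by
      rw [← hA]
      exact fun h => hba ((G.mem_cluster).1 h))
  rw [hB]
  intro x hx
  exact mem_of_conn_compl_interiorFlip (G.self_mem_cluster Tᶜ b) ((G.mem_cluster).1 hx)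

/-- The blue cluster of `b` after the double flip is red-connected in `T` inside itself: every vertex
of it reaches `b` by a `T`-red walk inside the cluster. -/
theorem walkInside_of_mem_cluster_doubleFlip_b {T : Config E} {a b x : V} (hab : ¬ G.Conn Tᶜ b a)
    (hx : x ∈ G.cluster (G.doubleFlip T a b)ᶜ b) :
    G.WalkInside T (G.cluster (G.doubleFlip T a b)ᶜ b) x b := by
  have hba : ¬ G.Conn Tᶜ a b := fun h => hab h.symm
  have hA : G.cluster Tᶜ a = G.cluster (G.interiorFlip T (G.cluster Tᶜ b))ᶜ a :=
    (cluster_compl_interiorFlip_of_not_mem (fun h => hab ((G.mem_cluster).1 h))).symm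
  -- the second flip (inside `D_a`) leaves the blue cluster of `b` of the first flip unchanged
  have hB : G.cluster (G.doubleFlip T a b)ᶜ b =
      G.cluster (G.interiorFlip T (G.cluster Tᶜ b))ᶜ b := by
    rw [doubleFlip_eq hab, hA]
    exact cluster_compl_interiorFlip_of_not_mem (by
      rw [← hA]
      exact fun h => hba ((G.mem_cluster).1 h))
  rw [hB] at hx ⊢
  -- a blue walk of the first flip from `b` stays inside `D_b` and uses old red edges inside `D_b`
  refine ⟨hx, ?_⟩
  have h : G.Conn (G.interiorFlip T (G.cluster Tᶜ b))ᶜ x b := ((G.mem_cluster).1 hx).symm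
  refine Conn.induction (G := G) (ω := (G.interiorFlip T (G.cluster Tᶜ b))ᶜ) (u := x)
    (motive := fun v => Relation.ReflTransGen
      (fun p q => G.OpenAdj T p q ∧ q ∈ G.cluster (G.interiorFlip T (G.cluster Tᶜ b))ᶜ b) x v)
    Relation.ReflTransGen.refl ?_ h
  intro p q hxp hpq ih
  have hp : p ∈ G.cluster (G.interiorFlip T (G.cluster Tᶜ b))ᶜ b :=
    (G.mem_cluster).2 (((G.mem_cluster).1 hx).trans hxp)
  have hq : q ∈ G.cluster (G.interiorFlip T (G.cluster Tᶜ b))ᶜ b :=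
    (G.mem_cluster).2 (((G.mem_cluster).1 hp).trans (Conn.of_openAdj hpq))
  -- both endpoints lie in `D_b`, so the edge is flipped: blue after the flip means red in `T`
  have hpD : p ∈ G.cluster Tᶜ b :=
    mem_of_conn_compl_interiorFlip (G.self_mem_cluster Tᶜ b) ((G.mem_cluster).1 hp)
  have hqD : q ∈ G.cluster Tᶜ b :=
    mem_of_conn_compl_interiorFlip (G.self_mem_cluster Tᶜ b) ((G.mem_cluster).1 hq)
  refine ih.tail ⟨?_, hq⟩
  obtain ⟨e, he, hend⟩ := hpq
  refine ⟨e, ?_, hend⟩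
  have hboth : G.fst e ∈ G.cluster Tᶜ b ∧ G.snd e ∈ G.cluster Tᶜ b := by
    rcases hend with ⟨h1, h2⟩ | ⟨h1, h2⟩
    · exact ⟨h1 ▸ hpD, h2 ▸ hqD⟩
    · exact ⟨h1 ▸ hqD, h2 ▸ hpD⟩
  rw [Pi.compl_apply, interiorFlip_apply_of_both hboth.1 hboth.2] at he
  cases hT : T e
  · rw [hT] at he
    exact absurd he (by decide)
  · rfl

/-- The two interior flips commute when the clusters are disjoint: both orders flip exactly the
edges inside `D_a` or inside `D_b`. -/
theorem doubleFlip_comm {T : Config E} {a b : V} (hab : ¬ G.Conn Tᶜ a b) :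
    G.doubleFlip T a b = G.doubleFlip T b a := by
  have hba : ¬ G.Conn Tᶜ b a := fun h => hab h.symm
  have hdisj : Disjoint (G.cluster Tᶜ a) (G.cluster Tᶜ b) := disjoint_cluster_of_not_conn hab
  rw [doubleFlip_eq hba, doubleFlip_eq hab]
  funext e
  by_cases ha : G.fst e ∈ G.cluster Tᶜ a ∧ G.snd e ∈ G.cluster Tᶜ a
  · have hb : ¬ (G.fst e ∈ G.cluster Tᶜ b ∧ G.snd e ∈ G.cluster Tᶜ b) :=
      fun hb => Set.disjoint_left.1 hdisj ha.1 hb.1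
    rw [interiorFlip_apply_of_both ha.1 ha.2, interiorFlip_apply_of_not_both hb,
      interiorFlip_apply_of_not_both hb, interiorFlip_apply_of_both ha.1 ha.2]
  · by_cases hb : G.fst e ∈ G.cluster Tᶜ b ∧ G.snd e ∈ G.cluster Tᶜ b
    · rw [interiorFlip_apply_of_not_both ha, interiorFlip_apply_of_both hb.1 hb.2,
        interiorFlip_apply_of_both hb.1 hb.2, interiorFlip_apply_of_not_both ha]
    · rw [interiorFlip_apply_of_not_both ha, interiorFlip_apply_of_not_both hb,
        interiorFlip_apply_of_not_both hb, interiorFlip_apply_of_not_both ha]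

/-- **The double flip maps every Bad source to a Good one** (mine-3 §41 (d)): for a `(D,A)`
configuration `T`, either `T ∈ Good₁ ∪ Good₂` or `τ(T) = σ_a(σ_b(T)) = σ_b(σ_a(T))` is in `Good₂`
(when a `T`-red path from `c` to `a` first enters `D_a`) or in `Good₁` (when it first enters `D_b`). -/
theorem good_doubleFlip {T : Config E} {a b c : V} (hca : G.Conn T c a) (hab : ¬ G.Conn Tᶜ a b) :
    G.WalkAvoiding T (G.cluster Tᶜ a) c b ∨ G.WalkAvoiding T (G.cluster Tᶜ b) c a ∨
      G.WalkAvoiding (G.doubleFlip T a b) (G.cluster (G.doubleFlip T a b)ᶜ b) c a ∨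
      G.WalkAvoiding (G.doubleFlip T a b) (G.cluster (G.doubleFlip T a b)ᶜ a) c b := by
  have hba : ¬ G.Conn Tᶜ b a := fun h => hab h.symm
  have hdisj : Disjoint (G.cluster Tᶜ a) (G.cluster Tᶜ b) := disjoint_cluster_of_not_conn hab
  -- cut a `T`-red path from `c` to `a` at its first vertex in `D_a ∪ D_b`
  obtain ⟨w, hw, hwalk⟩ :=
    exists_first_mem_of_reflTransGen (r := G.OpenAdj T) (Y := G.cluster Tᶜ a ∪ G.cluster Tᶜ b)
      hca (Set.mem_union_left _ (G.self_mem_cluster Tᶜ a))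
  rcases hw with hwa | hwb
  · -- the path enters `D_a` first: the two-cluster theorem with `Y₁ = D_a` and `Y₂` = the blue
    -- cluster of `b` in `τ(T) = σ_a(σ_b(T))`
    have key := two_cluster (G := G) (ω := T) (τ := G.doubleFlip T a b) (Y₁ := G.cluster Tᶜ a)
      (Y₂ := G.cluster (G.doubleFlip T a b)ᶜ b) (a := a) (b := b) (c := c)
      (hdisj.mono_right (cluster_doubleFlip_b_subset hba))
      (fun x hx => walkInside_of_mem_cluster_doubleFlip_b hba hx)
      (fun x hx => walkInside_doubleFlip_of_mem_a hba hx (G.self_mem_cluster Tᶜ a))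
      ⟨w, hwa, reflTransGen_of_imp (fun p q hpq =>
        ⟨openAdj_inf_doubleFlip_of_not_mem hba (fun hp => hpq.2 (Set.mem_union_left _ hp))
          (fun hp => hpq.2 (Set.mem_union_right _ hp)) hpq.1,
         fun hp => hpq.2 (Set.mem_union_left _ hp)⟩) hwalk⟩
    rcases key with h | h
    · exact Or.inl h
    · exact Or.inr (Or.inr (Or.inl h))
  · -- the path enters `D_b` first: the same with the roles of `a` and `b` exchanged
    have key := two_cluster (G := G) (ω := T) (τ := G.doubleFlip T b a) (Y₁ := G.cluster Tᶜ b)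
      (Y₂ := G.cluster (G.doubleFlip T b a)ᶜ a) (a := b) (b := a) (c := c)
      (hdisj.symm.mono_right (cluster_doubleFlip_b_subset hab))
      (fun x hx => walkInside_of_mem_cluster_doubleFlip_b hab hx)
      (fun x hx => walkInside_doubleFlip_of_mem_a hab hx (G.self_mem_cluster Tᶜ b))
      ⟨w, hwb, reflTransGen_of_imp (fun p q hpq =>
        ⟨openAdj_inf_doubleFlip_of_not_mem hab (fun hp => hpq.2 (Set.mem_union_right _ hp))
          (fun hp => hpq.2 (Set.mem_union_left _ hp)) hpq.1,
         fun hp => hpq.2 (Set.mem_union_right _ hp)⟩) hwalk⟩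
    rcases key with h | h
    · exact Or.inr (Or.inl h)
    · rw [doubleFlip_comm hab]
      exact Or.inr (Or.inr (Or.inr h))

end MultiGraph

end PercRepro
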